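import Summits.HodgeConjecture.HodgeConjecture.Theses.HeckePrymWeil
import Summits.HodgeConjecture.HodgeConjecture.Theorems.WeilTwelvefoldsSqrtMinus7.Negative.EigenvalueTyping

/-!
# `WeilTwelvefoldsSqrtMinus7` (stmt-HodgeConjecture-1261) · Negative · the descent polynomial (`stub_descent`)

Support / tightness knowledge for the crux `HeckePrymWeil.WeilTwelvefoldsSqrtMinus7`, from the standing
disprover's work file `Cruxes/WeilTwelvefoldsSqrtMinus7/Disproof.lean` §11b
(refuter-cdisprove-stmt-HodgeConjecture-1261-g4-0, cycle 4, 2026-08-16).  Both registered lines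
(`Lines/amnesic-secant-sheaves-split-fourteenfolds.lean` stub S5, `Lines/isotypic-unimodular-saturation.lean`
stub 6) descend `14 → 12` along `A × B ↝ A` by decomposing `P = pr_A^*(c₊+c₋) ⌣ pr_B^*(b₊+b₋)` under
`T = (𝟙+ψ)^*` into four eigen-pieces with eigenvalues `λ₊¹⁴, λ₋¹⁴, λ₊¹²λ₋², λ₋¹²λ₊²` (`λ± = 1 ± i√7`) and
applying `q(T)`, `q(X) = (X - λ₊¹²λ₋²)(X - λ₋¹²λ₊²)`, claimed to lie in `ℤ[X]`.  This file supplies the exact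
constants and the separation facts (all from the landed `one_add_I_sqrt7_pow_ne`, `one_add_I_sqrt7_pow`):

* `descent_eigenvalues_distinct` : the four eigenvalues are pairwise distinct;
* `descent_mixedEigenvalues_sum` / `_prod` : `q(X) = X² - 3735552·X + 4398046511104` (`β+β̄ = 2·8²·Re(1+√-7)¹⁰`,
  `ββ̄ = 8¹⁴`), with `one_add_sqrtNeg7_pow_ten : (1+√-7)¹⁰ = 29184 - 5632√-7`;
* `descentPoly_ne_zero_at_weil` : `q(λ₊¹⁴) ≠ 0 ≠ q(λ₋¹⁴)` — `q(T)` kills exactly the mixed pieces;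
* `one_add_I_sqrt7_pow_fourteen` : `(1+i√7)¹⁴ = -712704 - 745472·i√7` (the Weil eigenvalue one Witt step up).
-/

noncomputable section

set_option linter.dupNamespace false

open Complex

namespace Summit.HodgeConjecture.HodgeConjecture.Theorems.WeilTwelvefoldsSqrtMinus7.Negative

/-- `√7 : ℂ` spelled as in the crux. -/
local notation "√7" => ((Real.sqrt (7 : ℝ) : ℝ) : ℂ)

/-- `λ₊ λ₋ = 8`. [folklore] -/
theorem lam_mul_lamBar : (1 + I * √7) * (1 - I * √7) = 8 := by
  have h : (1 + I * √7) * (1 - I * √7) = 1 - (I * √7) * (I * √7) := by ring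
  rw [h, I_mul_sqrt7_mul_self]
  push_cast
  ring

/-- `(1+√-7)^10 = 29184 - 5632 √-7`. [folklore] -/
theorem one_add_sqrtNeg7_pow_ten : (⟨1, 1⟩ : ℤ√(-7)) ^ 10 = ⟨29184, -5632⟩ := by decide

/-- `(1+√-7)^14 = -712704 - 745472 √-7` (the Weil eigenvalue one Witt step up). [folklore] -/
theorem one_add_sqrtNeg7_pow_fourteen : (⟨1, 1⟩ : ℤ√(-7)) ^ 14 = ⟨-712704, -745472⟩ := by decide

/-- **The descent polynomial has integer coefficients**: with `β = λ₊¹²λ₋²`, `β̄ = λ₋¹²λ₊²`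
(`λ± = 1 ± i√7`), `β + β̄ = 2·8²·Re (1+√-7)^10 = 3735552`. [folklore] -/
theorem descent_mixedEigenvalues_sum :
    (1 + I * √7) ^ 12 * (1 - I * √7) ^ 2 + (1 - I * √7) ^ 12 * (1 + I * √7) ^ 2 = 3735552 := by
  have h1 : (1 + I * √7) ^ 12 * (1 - I * √7) ^ 2 =
      ((1 + I * √7) * (1 - I * √7)) ^ 2 * (1 + I * √7) ^ 10 := by ring
  have h2 : (1 - I * √7) ^ 12 * (1 + I * √7) ^ 2 =
      ((1 + I * √7) * (1 - I * √7)) ^ 2 * (1 - I * √7) ^ 10 := by ring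
  rw [h1, h2, lam_mul_lamBar, one_add_I_sqrt7_pow 10, one_sub_I_sqrt7_pow 10, one_add_sqrtNeg7_pow_ten]
  push_cast
  ring

/-- … and `β β̄ = 8¹⁴ = 4398046511104`; so `q(X) = X² - 3735552·X + 4398046511104 ∈ ℤ[X]`. [folklore] -/
theorem descent_mixedEigenvalues_prod :
    ((1 + I * √7) ^ 12 * (1 - I * √7) ^ 2) * ((1 - I * √7) ^ 12 * (1 + I * √7) ^ 2) =
      4398046511104 := by
  have h : ((1 + I * √7) ^ 12 * (1 - I * √7) ^ 2) * ((1 - I * √7) ^ 12 * (1 + I * √7) ^ 2) =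
      ((1 + I * √7) * (1 - I * √7)) ^ 14 := by ring
  rw [h, lam_mul_lamBar]
  norm_num

/-- The Weil eigenvalue one Witt step up: `(1+i√7)^14 = -712704 - 745472·i√7`. [folklore] -/
theorem one_add_I_sqrt7_pow_fourteen :
    (1 + I * √7) ^ 14 = (-712704 : ℂ) + (-745472 : ℂ) * (I * √7) := by
  rw [one_add_I_sqrt7_pow 14, one_add_sqrtNeg7_pow_fourteen]
  push_cast
  ring

/-- **The four `(𝟙+ψ)^*`-eigenvalues on `pr_A^*(c₊ + c₋) ⌣ pr_B^*(b₊ + b₋)` are pairwise distinct**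
(`λ₊¹⁴, λ₋¹⁴, λ₊¹²λ₋², λ₋¹²λ₊²`): each coincidence would force `λ₊ⁿ = λ₋ⁿ` for some `n ∈ {2, 10, 12, 14}`,
excluded by `one_add_I_sqrt7_pow_ne`.  So `q(T)` (`T = (𝟙+ψ)^*`) kills exactly the two mixed pieces. [folklore] -/
theorem descent_eigenvalues_distinct :
    (1 + I * √7) ^ 14 ≠ (1 - I * √7) ^ 14 ∧
    (1 + I * √7) ^ 14 ≠ (1 + I * √7) ^ 12 * (1 - I * √7) ^ 2 ∧
    (1 + I * √7) ^ 14 ≠ (1 - I * √7) ^ 12 * (1 + I * √7) ^ 2 ∧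
    (1 - I * √7) ^ 14 ≠ (1 + I * √7) ^ 12 * (1 - I * √7) ^ 2 ∧
    (1 - I * √7) ^ 14 ≠ (1 - I * √7) ^ 12 * (1 + I * √7) ^ 2 ∧
    (1 + I * √7) ^ 12 * (1 - I * √7) ^ 2 ≠ (1 - I * √7) ^ 12 * (1 + I * √7) ^ 2 := by
  have hp : (1 + I * √7) ≠ 0 := one_add_I_sqrt7_ne_zero
  have hm : (1 - I * √7) ≠ 0 := one_sub_I_sqrt7_ne_zero
  refine ⟨one_add_I_sqrt7_pow_ne 14 (by norm_num), ?_, ?_, ?_, ?_, ?_⟩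
  · intro h
    apply one_add_I_sqrt7_pow_ne 2 (by norm_num)
    have h' : (1 + I * √7) ^ 12 * (1 + I * √7) ^ 2 = (1 + I * √7) ^ 12 * (1 - I * √7) ^ 2 := by
      rw [← pow_add]; exact h
    exact mul_left_cancel₀ (pow_ne_zero 12 hp) h'
  · intro h
    apply one_add_I_sqrt7_pow_ne 12 (by norm_num)
    have h' : (1 + I * √7) ^ 12 * (1 + I * √7) ^ 2 = (1 - I * √7) ^ 12 * (1 + I * √7) ^ 2 := by
      rw [← pow_add]; exact h
    exact mul_right_cancel₀ (pow_ne_zero 2 hp) h'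
  · intro h
    apply one_add_I_sqrt7_pow_ne 12 (by norm_num)
    have h' : (1 - I * √7) ^ 12 * (1 - I * √7) ^ 2 = (1 + I * √7) ^ 12 * (1 - I * √7) ^ 2 := by
      rw [← pow_add]; exact h
    exact (mul_right_cancel₀ (pow_ne_zero 2 hm) h').symm
  · intro h
    apply one_add_I_sqrt7_pow_ne 2 (by norm_num)
    have h' : (1 - I * √7) ^ 12 * (1 - I * √7) ^ 2 = (1 - I * √7) ^ 12 * (1 + I * √7) ^ 2 := by
      rw [← pow_add]; exact h
    exact (mul_left_cancel₀ (pow_ne_zero 12 hm) h').symm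
  · intro h
    apply one_add_I_sqrt7_pow_ne 10 (by norm_num)
    have h' : ((1 + I * √7) * (1 - I * √7)) ^ 2 * (1 + I * √7) ^ 10 =
        ((1 + I * √7) * (1 - I * √7)) ^ 2 * (1 - I * √7) ^ 10 := by
      have e1 : (1 + I * √7) ^ 12 * (1 - I * √7) ^ 2 =
          ((1 + I * √7) * (1 - I * √7)) ^ 2 * (1 + I * √7) ^ 10 := by ring
      have e2 : (1 - I * √7) ^ 12 * (1 + I * √7) ^ 2 =
          ((1 + I * √7) * (1 - I * √7)) ^ 2 * (1 - I * √7) ^ 10 := by ring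
      rw [← e1, ← e2]; exact h
    exact mul_left_cancel₀ (pow_ne_zero 2 (mul_ne_zero hp hm)) h'

/-- `q(λ₊¹⁴) ≠ 0 ≠ q(λ₋¹⁴)`: the descent polynomial does not kill the two Weil pieces. [folklore] -/
theorem descentPoly_ne_zero_at_weil :
    ((1 + I * √7) ^ 14 - (1 + I * √7) ^ 12 * (1 - I * √7) ^ 2) *
        ((1 + I * √7) ^ 14 - (1 - I * √7) ^ 12 * (1 + I * √7) ^ 2) ≠ 0 ∧
    ((1 - I * √7) ^ 14 - (1 + I * √7) ^ 12 * (1 - I * √7) ^ 2) *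
        ((1 - I * √7) ^ 14 - (1 - I * √7) ^ 12 * (1 + I * √7) ^ 2) ≠ 0 := by
  obtain ⟨-, h2, h3, h4, h5, -⟩ := descent_eigenvalues_distinct
  exact ⟨mul_ne_zero (sub_ne_zero.2 h2) (sub_ne_zero.2 h3),
    mul_ne_zero (sub_ne_zero.2 h4) (sub_ne_zero.2 h5)⟩

end Summit.HodgeConjecture.HodgeConjecture.Theorems.WeilTwelvefoldsSqrtMinus7.Negative

end
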